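import Summits.BirchSwinnertonDyer.BirchSwinnertonDyer.Theorems.ByReductionTypeAtTwoAnalyticMuDepthLemmas
import Summits.BirchSwinnertonDyer.Rank1Residual.X1.MuPart
import Literature.NumberTheory.EllipticCurves.SkinnerUrban2014.PAdicUnitPeriodRatioAnyPrimeProofs
import Literature.NumberTheory.EllipticCurves.ManinConstantSemistablePrimewise
import HarnessLib

/-!
# Route `ByReductionTypeAtTwo` (K4), crux `OrdMissingLowerBoundAtTwo` (stmt-BirchSwinnertonDyer-19577), line
# `kato-free-lower-sandwich-two` — S2 (analytic half) AT EVERY DEPTH: `μ(L₂(f,α)) ≥ s+1` forces every doubled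
# Mazur–Swinnerton-Dyer value to vanish mod `2^{s+1}` (`--supports`, helper)

Cell `bsd-2adic`, lead `cruxlead-stmt-BirchSwinnertonDyer-19577` (g0).  THEOREMS ONLY — no definition, no named fact, no
`sorry`.  HONEST FRAMING: the crux 19577 and its research stub `stub_analyticMuLEAtMaxPeriod` are NOT closed here; BSD is not
proved by any of this.

WHAT.  The tree's `μ = 0` certificate at `p = 2` (`AnalyticMuTwo.exists_norm_padicLCoeff_two_eq_one_of_orbit`, p641152 road)
is the depth-ONE case of «Gauss norm of `L₂(f,α,T)` = sup norm of the measure `μ_{f,α}`»: a UNIT doubled value forces a unit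
coefficient.  Card #8 (`odd-point-shimura-descent-two`) of crux 19577 needs the converse direction AT EVERY DEPTH — its piece
S2_s «`μ ≥ s` ⟹ the dyadic profile of the winding functional is `2^s`-flat» begins with: ALL coefficients `c_k` of
`L₂(f,α,T)` of norm `≤ 2^{-(s+1)}` ⟹ ALL doubled values `ν_n(s₀) = 2μ_{f,α}(5^{s₀} + 2ⁿ⁺²ℤ₂)` of norm `≤ 2^{-(s+1)}`.
This file proves exactly that (`norm_two_mul_msdMeasure_le_of_forall_norm_padicLCoeff_le`, and the odd-class / curve-level
forms), from three ingredients: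
* §1 forward differences of a `2ⁿ`-PERIODIC integer-valued function: `2^{⌊k/2ⁿ⌋} ∣ Δᵏg` (`(E−1)^{2ⁿ} ≡ E^{2ⁿ} − 1 (mod 2)`),
  so the Mahler–Newton coefficients of the indicator of a class mod `2ⁿ` DECAY 2-adically;
* §2 the SHARPENED Lucas congruence `2^{j+1} ∣ C(x,k) − C(y,k)` for `x ≡ y (mod 2^{n+j})`, `k < 2ⁿ` (Vandermonde +
  `v₂(C(d,i)) ≥ v₂(d) − v₂(i)`), hence `‖c_k − RS(k,M)‖ ≤ 2^{-(j+1)}` for the Riemann sums at level `M ≥ n + j`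
  (the tree has `j = 0`: `norm_padicLRiemannSum_two_sub_le_half`);
* §3 the multi-step distribution relation on the exponent line and the Newton expansion
  `ν_n(s₀) = Σ_{k<2^M} b_k·RS(k,M)` with `b_k = Δᵏ𝟙(0) ∈ ℤ`: small `k` are controlled by §2, large `k` by §1.
§4 reads it for the newform of a good-ordinary curve (`msdMeasure_distribution_of_isNewformOf`,
`norm_msdMeasure_two_le_two_auto`): if the Néron-type rescaling `ϖ·L₂(f,α)` by a 2-adic UNIT `ϖ` (the optimal curve's ratio,
Abbes–Ullmo) has all coefficients of norm `≤ 2^{-(s+1)}` — i.e. `AnalyticMuLE · 2 s` FAILS — then every doubled value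
`2μ_{f,α}(b + 2ⁿ⁺²ℤ₂)`, `b` odd, has norm `≤ 2^{-(s+1)}`.  The remaining half of S2 (the MSD recursion `α·w_n ≡ w_{n−1} − κ`
turning this into `2^{s+1}`-flatness of the integer functional `m_f`) and S3/S4 are not in this file.

References: B. Mazur, J. Tate, J. Teitelbaum, Invent. Math. 84 (1986), §I.10–I.13; L. Washington, GTM 83, §7.2 (Mahler /
Newton interpolation); K. Mahler, J. reine angew. Math. 199 (1958).
-/

-- the summit namespace repeats `BirchSwinnertonDyer` by design (summit = problem); linter moot
set_option linter.dupNamespace false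
set_option autoImplicit false

noncomputable section

namespace Summit.BirchSwinnertonDyer.BirchSwinnertonDyer.Theorems.AnalyticMuTwo

open Filter Topology Finset
open scoped MatrixGroups ModularForm fwdDiff
open CongruenceSubgroup WeierstrassCurve Literature.NumberTheory.EllipticCurves
  Literature.NumberTheory.EllipticCurves.ModularForms Literature.NumberTheory.EllipticCurves.Rank1Residual

/-! ## §3 The doubled values from the coefficients -/

section Depth

variable {N : ℕ} [NeZero N] (f : CuspForm (Gamma0 N) 2) (α : ℚ_[2])

/-- **Multi-step distribution relation on the exponent line**: the doubled value `ν_n(s)` is the sum of the doubled values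
`ν_{n+d}(s')` over `s' ≡ s (mod 2ⁿ)` (iterate `sum_fiber_two_mul_msdMeasure_succ_eq`). [cite: MazurTateTeitelbaum1986Invent, §I.11] -/
theorem two_mul_msdMeasure_eq_sum_filter_val_mod
    (hdist : ∀ (n : ℕ) (a : ZMod (2 ^ n)),
      ∑ b ∈ Finset.univ.filter (fun b : ZMod (2 ^ (n + 1)) ↦
        ZMod.castHom (pow_dvd_pow 2 n.le_succ) (ZMod (2 ^ n)) b = a), msdMeasure f α (n + 1) b =
        msdMeasure f α n a)
    (n d : ℕ) (s : ZMod (2 ^ n)) :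
    2 * msdMeasure f α (n + 2) ((cyclotomicGenerator 2 : ZMod (2 ^ (n + 2))) ^ s.val) =
      ∑ s' ∈ Finset.univ.filter (fun s' : ZMod (2 ^ (n + d)) ↦ s'.val % 2 ^ n = s.val),
        2 * msdMeasure f α (n + d + 2) ((cyclotomicGenerator 2 : ZMod (2 ^ (n + d + 2))) ^ s'.val) := by
  classical
  induction d with
  | zero =>
    haveI : NeZero (2 ^ n) := ⟨pow_ne_zero _ two_ne_zero⟩
    have hfilter : Finset.univ.filter (fun s' : ZMod (2 ^ (n + 0)) ↦ s'.val % 2 ^ n = s.val) = {s} := by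
      ext s'
      simp only [Finset.mem_filter, Finset.mem_univ, true_and, Finset.mem_singleton, Nat.add_zero]
      rw [Nat.mod_eq_of_lt (by simpa using ZMod.val_lt s')]
      exact (ZMod.val_injective _).eq_iff
    simp only [Nat.add_zero] at hfilter ⊢
    rw [hfilter, Finset.sum_singleton]
  | succ d ih =>
    haveI : NeZero (2 ^ (n + d)) := ⟨pow_ne_zero _ two_ne_zero⟩
    haveI : NeZero (2 ^ (n + d + 1)) := ⟨pow_ne_zero _ two_ne_zero⟩
    rw [ih]
    set π : ZMod (2 ^ (n + d + 1)) → ZMod (2 ^ (n + d)) :=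
      fun s' ↦ ZMod.castHom (pow_dvd_pow 2 (n + d).le_succ) (ZMod (2 ^ (n + d))) s' with hπ
    have hπval : ∀ s' : ZMod (2 ^ (n + d + 1)), (π s').val = s'.val % 2 ^ (n + d) := by
      intro s'
      rw [hπ]
      dsimp only
      rw [ZMod.castHom_apply, ZMod.cast_eq_val, ZMod.val_natCast]
    -- regroup the level-(n+d+1) sum over the fibres of `π`
    have hmodmod : ∀ s' : ZMod (2 ^ (n + d + 1)), (π s').val % 2 ^ n = s'.val % 2 ^ n := by
      intro s'
      rw [hπval, Nat.mod_mod_of_dvd _ (pow_dvd_pow 2 (Nat.le_add_right n d))]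
    rw [show n + (d + 1) = n + d + 1 by ring]
    symm
    rw [← Finset.sum_fiberwise_of_maps_to (g := π)
      (t := Finset.univ.filter (fun s' : ZMod (2 ^ (n + d)) ↦ s'.val % 2 ^ n = s.val))
      (fun s' hs' ↦ by
        rw [Finset.mem_filter] at hs' ⊢
        exact ⟨Finset.mem_univ _, by rw [hmodmod]; exact hs'.2⟩)]
    refine Finset.sum_congr rfl fun s₁ hs₁ ↦ ?_
    rw [← sum_fiber_two_mul_msdMeasure_succ_eq f α hdist (n + d) s₁]
    refine Finset.sum_congr ?_ fun _ _ ↦ rfl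
    ext s'
    simp only [Finset.mem_filter, Finset.mem_univ, true_and]
    rw [Finset.mem_filter] at hs₁
    constructor
    · rintro ⟨_, h⟩; exact h
    · intro h
      refine ⟨?_, h⟩
      have hπs : π s' = s₁ := h
      rw [← hmodmod, hπs]
      exact hs₁.2

/-- `two_mul_msdMeasure_eq_sum_filter_val_mod` with the target level `M ≥ n` as a free parameter. [folklore] -/
theorem two_mul_msdMeasure_eq_sum_filter_val_mod'
    (hdist : ∀ (n : ℕ) (a : ZMod (2 ^ n)),
      ∑ b ∈ Finset.univ.filter (fun b : ZMod (2 ^ (n + 1)) ↦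
        ZMod.castHom (pow_dvd_pow 2 n.le_succ) (ZMod (2 ^ n)) b = a), msdMeasure f α (n + 1) b =
        msdMeasure f α n a)
    {n M : ℕ} (hM : n ≤ M) (s : ZMod (2 ^ n)) :
    2 * msdMeasure f α (n + 2) ((cyclotomicGenerator 2 : ZMod (2 ^ (n + 2))) ^ s.val) =
      ∑ s' ∈ Finset.univ.filter (fun s' : ZMod (2 ^ M) ↦ s'.val % 2 ^ n = s.val),
        2 * msdMeasure f α (M + 2) ((cyclotomicGenerator 2 : ZMod (2 ^ (M + 2))) ^ s'.val) := by
  obtain ⟨d, rfl⟩ := Nat.exists_eq_add_of_le hM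
  exact two_mul_msdMeasure_eq_sum_filter_val_mod f α hdist n d s

/-- **S2, analytic half, at every depth (`p = 2`): `μ(L₂(f,α)) ≥ s+1` forces ALL doubled Mazur–Swinnerton-Dyer values
on the exponent line to vanish mod `2^{s+1}`.**  If `‖c_k‖₂ ≤ 2^{-(s+1)}` for every coefficient `c_k` of `L₂(f,α,T)` then
`‖2μ_{f,α}(5^{s₀} + 2ⁿ⁺²ℤ₂)‖₂ ≤ 2^{-(s+1)}` for all `n, s₀` (granted the distribution relation and `‖μ_{f,α}‖ ≤ 2`).
Proof: Newton-expand the indicator of the class `s₀ mod 2ⁿ` on `ℤ/2^M`, `M = n + 2s + 2`: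
`ν_n(s₀) = Σ_{k<2^M} b_k·RS(k,M)` with `b_k = Δᵏ𝟙(0) ∈ ℤ`; for `k < 2^{n+1}(s+1) ≤ 2^{n+s+2}` the Riemann sum is
`2^{-(s+1)}`-close to `c_k` (§2), for larger `k` the coefficient `b_k` is divisible by `2^{⌊k/2^{n+1}⌋} ≥ 2^{s+1}` (§1)
while `‖RS(k,M)‖ ≤ 1`. (Sup norm ≤ Gauss norm for these measures; the converse inequality is the tree's certificate.)
[cite: MazurTateTeitelbaum1986Invent, §I.11–I.13] [cite: Washington1997, §7.2] -/
theorem norm_two_mul_msdMeasure_le_of_forall_norm_padicLCoeff_le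
    (hdist : ∀ (n : ℕ) (a : ZMod (2 ^ n)),
      ∑ b ∈ Finset.univ.filter (fun b : ZMod (2 ^ (n + 1)) ↦
        ZMod.castHom (pow_dvd_pow 2 n.le_succ) (ZMod (2 ^ n)) b = a), msdMeasure f α (n + 1) b =
        msdMeasure f α n a)
    (hμ : ∀ (m : ℕ) (a : ZMod (2 ^ m)), ‖msdMeasure f α m a‖ ≤ 2)
    {s : ℕ} (hc : ∀ k : ℕ, ‖padicLCoeff f α k‖ ≤ (2 : ℝ) ^ (-((s : ℤ) + 1)))
    (n : ℕ) (s₀ : ZMod (2 ^ n)) :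
    ‖2 * msdMeasure f α (n + 2) ((cyclotomicGenerator 2 : ZMod (2 ^ (n + 2))) ^ s₀.val)‖ ≤
      (2 : ℝ) ^ (-((s : ℤ) + 1)) := by
  classical
  haveI : Fact (Nat.Prime 2) := ⟨Nat.prime_two⟩
  set B : ℝ := (2 : ℝ) ^ (-((s : ℤ) + 1)) with hB
  have hB0 : 0 ≤ B := zpow_nonneg (by norm_num) _
  have hB1 : B ≤ 1 := zpow_le_one_of_nonpos₀ (by norm_num) (by omega)
  have h2norm : ‖(2 : ℚ_[2])‖ = 2⁻¹ := by simpa using Padic.norm_p (p := 2)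
  have hν : ∀ (m : ℕ) (a : ZMod (2 ^ (m + 2))), ‖2 * msdMeasure f α (m + 2) a‖ ≤ 1 := by
    intro m a
    rw [norm_mul, h2norm]
    calc (2 : ℝ)⁻¹ * ‖msdMeasure f α (m + 2) a‖ ≤ 2⁻¹ * 2 := by gcongr; exact hμ _ _
      _ = 1 := by norm_num
  -- parameters: period exponent `n+1`, cut-off `K = 2^{n+1}(s+1) ≤ 2^{n₁}`, level `M = n₁ + s = n + d`
  set n₁ : ℕ := n + 1 + (s + 1) with hn₁
  set M : ℕ := n + (2 * s + 2) with hM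
  have hMn : n ≤ M := by omega
  have hMn₁ : n₁ + s ≤ M := by omega
  have hK : 2 ^ (n + 1) * (s + 1) ≤ 2 ^ n₁ := by
    rw [hn₁, pow_add 2 (n + 1) (s + 1)]
    exact Nat.mul_le_mul_left _ (Nat.lt_two_pow_self).le
  -- the indicator of the class `s₀ mod 2ⁿ` and its Mahler (Newton) coefficients
  set g : ℕ → ℤ := fun x => if x % 2 ^ n = s₀.val then 1 else 0 with hg
  have hper : ∀ x, g (x + 2 ^ (n + 1)) = g x := by
    intro x
    simp only [hg, pow_succ, Nat.add_mul_mod_self_left]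
  set b : ℕ → ℤ := fun k => (Δ_[1])^[k] g 0 with hb
  have hb1 : ∀ k, ‖((b k : ℤ) : ℚ_[2])‖ ≤ 1 := fun k => Padic.norm_int_le_one _
  have hbK : ∀ k, 2 ^ (n + 1) * (s + 1) ≤ k → ‖((b k : ℤ) : ℚ_[2])‖ ≤ B := by
    intro k hk
    have hdvd : (2 : ℤ) ^ (k / 2 ^ (n + 1)) ∣ b k :=
      two_pow_dvd_fwdDiff_iter_of_periodic (by omega) hper k 0
    have hle : s + 1 ≤ k / 2 ^ (n + 1) := (Nat.le_div_iff_mul_le (pow_pos two_pos _)).mpr (by rwa [mul_comm])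
    have hdvd' : (2 : ℤ) ^ (s + 1) ∣ b k := (pow_dvd_pow 2 hle).trans hdvd
    have := (Padic.norm_int_le_pow_iff_dvd (b k) (s + 1)).mpr hdvd'
    rw [hB]
    exact_mod_cast this
  -- Newton: `g(x) = Σ_{k < 2^M} C(x,k) b_k` for `x < 2^M`
  have hnewton : ∀ x : ℕ, x < 2 ^ M → (g x : ℚ_[2]) =
      ∑ k ∈ Finset.range (2 ^ M), ((x.choose k : ℕ) : ℚ_[2]) * ((b k : ℤ) : ℚ_[2]) := by
    intro x hx
    have h := shift_eq_sum_fwdDiff_iter (1 : ℕ) g x 0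
    rw [zero_add, smul_eq_mul, mul_one] at h
    rw [h]
    push_cast
    rw [Finset.sum_subset (Finset.range_subset_range.mpr (by omega : x + 1 ≤ 2 ^ M))]
    · refine Finset.sum_congr rfl fun k _ => ?_
      simp only [nsmul_eq_mul, Int.cast_mul, Int.cast_natCast, hb]
    · intro k _ hk'
      rw [Finset.mem_range, not_lt] at hk'
      simp [Nat.choose_eq_zero_of_lt (by omega : x < k)]
  -- the doubled value as `Σ_k b_k · RS(k, M)`
  haveI : NeZero (2 ^ M) := ⟨pow_ne_zero _ two_ne_zero⟩
  have hsum : 2 * msdMeasure f α (n + 2) ((cyclotomicGenerator 2 : ZMod (2 ^ (n + 2))) ^ s₀.val) =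
      ∑ k ∈ Finset.range (2 ^ M), ((b k : ℤ) : ℚ_[2]) * padicLRiemannSum f α k M := by
    rw [two_mul_msdMeasure_eq_sum_filter_val_mod' f α hdist hMn s₀, Finset.sum_filter]
    refine (Finset.sum_congr rfl fun s' _ => show _ =
        2 * msdMeasure f α (M + 2) ((cyclotomicGenerator 2 : ZMod (2 ^ (M + 2))) ^ s'.val) *
          ∑ k ∈ Finset.range (2 ^ M), ((s'.val.choose k : ℕ) : ℚ_[2]) * ((b k : ℤ) : ℚ_[2]) from ?_).trans ?_
    · rw [← hnewton s'.val (ZMod.val_lt s')]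
      by_cases hP : s'.val % 2 ^ n = s₀.val <;> simp [hg, hP]
    simp_rw [Finset.mul_sum]
    rw [Finset.sum_comm]
    refine Finset.sum_congr rfl fun k _ => ?_
    rw [padicLRiemannSum_two_eq_sum, Finset.mul_sum]
    refine Finset.sum_congr rfl fun s' _ => ?_
    ring
  rw [hsum]
  refine IsUltrametricDist.norm_sum_le_of_forall_le_of_nonneg hB0 fun k hk => ?_
  rw [Finset.mem_range] at hk
  rw [norm_mul]
  by_cases hkK : k < 2 ^ (n + 1) * (s + 1)
  · -- small `k`: `RS(k,M)` is `2^{-(s+1)}`-close to `c_k`, itself `≤ 2^{-(s+1)}`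
    have hkn₁ : k < 2 ^ n₁ := lt_of_lt_of_le hkK hK
    have hRS : ‖padicLRiemannSum f α k M‖ ≤ B := by
      have herr := norm_padicLCoeff_sub_padicLRiemannSum_le_zpow f α hdist hμ (j := s) hkn₁ hMn₁
      calc ‖padicLRiemannSum f α k M‖
          = ‖padicLCoeff f α k + -(padicLCoeff f α k - padicLRiemannSum f α k M)‖ := by congr 1; ring
        _ ≤ max ‖padicLCoeff f α k‖ ‖-(padicLCoeff f α k - padicLRiemannSum f α k M)‖ :=
            Padic.nonarchimedean _ _
        _ ≤ B := by rw [norm_neg]; exact max_le (hc k) herr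
    calc _ ≤ 1 * B := mul_le_mul (hb1 k) hRS (norm_nonneg _) zero_le_one
      _ = B := one_mul B
  · -- large `k`: `b_k` is divisible by `2^{s+1}`, `RS(k,M)` is integral
    rw [not_lt] at hkK
    have hRS1 : ‖padicLRiemannSum f α k M‖ ≤ 1 := by
      rw [padicLRiemannSum_two_eq_sum]
      refine IsUltrametricDist.norm_sum_le_of_forall_le_of_nonneg zero_le_one fun s' _ => ?_
      rw [norm_mul]
      have hC1 : ‖((s'.val.choose k : ℕ) : ℚ_[2])‖ ≤ 1 := by
        exact_mod_cast Padic.norm_int_le_one ((s'.val.choose k : ℕ) : ℤ)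
      calc _ ≤ 1 * 1 := mul_le_mul (hν _ _) hC1 (norm_nonneg _) zero_le_one
        _ = 1 := one_mul 1
    calc _ ≤ B * 1 := mul_le_mul (hbK k hkK) hRS1 (norm_nonneg _) hB0
      _ = B := mul_one B

/-- **The same at every ODD class**: `‖2μ_{f,α}(b + 2ⁿ⁺²ℤ₂)‖₂ ≤ 2^{-(s+1)}` for `b` odd (every odd class is `±5^{s₀}`,
`exists_orbit_eq_of_odd`). [cite: MazurTateTeitelbaum1986Invent, §I.11–I.13] -/
theorem norm_two_mul_msdMeasure_le_of_forall_norm_padicLCoeff_le_of_odd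
    (hdist : ∀ (n : ℕ) (a : ZMod (2 ^ n)),
      ∑ b ∈ Finset.univ.filter (fun b : ZMod (2 ^ (n + 1)) ↦
        ZMod.castHom (pow_dvd_pow 2 n.le_succ) (ZMod (2 ^ n)) b = a), msdMeasure f α (n + 1) b =
        msdMeasure f α n a)
    (hμ : ∀ (m : ℕ) (a : ZMod (2 ^ m)), ‖msdMeasure f α m a‖ ≤ 2)
    {s : ℕ} (hc : ∀ k : ℕ, ‖padicLCoeff f α k‖ ≤ (2 : ℝ) ^ (-((s : ℤ) + 1)))
    (n : ℕ) {b : ZMod (2 ^ (n + 2))} (hb : ¬ 2 ∣ b.val) :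
    ‖2 * msdMeasure f α (n + 2) b‖ ≤ (2 : ℝ) ^ (-((s : ℤ) + 1)) := by
  obtain ⟨s₀, hs₀⟩ := exists_orbit_eq_of_odd f α hb
  rw [← hs₀]
  exact norm_two_mul_msdMeasure_le_of_forall_norm_padicLCoeff_le f α hdist hμ hc n s₀

end Depth

/-! ## §4 For the newform of a good-ordinary curve, with a unit Néron-type rescaling -/

section Curve

variable (W : WeierstrassCurve ℚ) [W.IsElliptic] [W.IsGloballyMinimal]

/-- **S2, analytic half, for a curve: the failure of `AnalyticMuLE` to depth `s` at a UNIT rescaling makes every doubled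
MSD value vanish mod `2^{s+1}`.**  `W` good ordinary at `2`, `f` a newform of `W`, `α = unitRoot W 2`, `ϖ ∈ ℚ` a 2-adic UNIT
(at the `X₀(N)`-optimal curve `ϖ₀ = Ω⁺_f/Ω(E₀)` is one, by Abbes–Ullmo): if every coefficient of `ϖ·L₂(f,α,T)` has norm
`≤ 2^{-(s+1)}` then `‖2μ_{f,α}(b + 2ⁿ⁺²ℤ₂)‖₂ ≤ 2^{-(s+1)}` for every `n` and every odd class `b`.  The distribution relation
and the bound `‖μ_{f,α}‖ ≤ 2` are the tree's `msdMeasure_distribution_of_isNewformOf` / `norm_msdMeasure_two_le_two_auto`.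
[cite: MazurTateTeitelbaum1986Invent, §I.10–I.13] -/
theorem norm_two_mul_msdMeasure_le_of_forall_norm_coeff_le (hord : IsOrdinaryAt W 2)
    {N : ℕ} [NeZero N] {f : CuspForm (Gamma0 N) 2} (hf : IsNewformOf W f)
    {ϖ : ℚ} (hϖ : ‖(ϖ : ℚ_[2])‖ = 1) {s : ℕ}
    (hsmall : ∀ k : ℕ, ‖PowerSeries.coeff k
      (PowerSeries.C (ϖ : ℚ_[2]) * padicLFunction f (unitRoot W 2 : ℚ_[2]))‖ ≤ (2 : ℝ) ^ (-((s : ℤ) + 1)))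
    (n : ℕ) {b : ZMod (2 ^ (n + 2))} (hb : ¬ 2 ∣ b.val) :
    ‖2 * msdMeasure f (unitRoot W 2 : ℚ_[2]) (n + 2) b‖ ≤ (2 : ℝ) ^ (-((s : ℤ) + 1)) := by
  haveI : Fact (Nat.Prime 2) := ⟨Nat.prime_two⟩
  obtain ⟨hαeq, hαu, hα0⟩ := unitRoot_coe_spec (W := W) hord
  have hαinv : ‖(unitRoot W 2 : ℚ_[2])⁻¹‖ ≤ 1 := by rw [norm_inv, hαu, inv_one]
  have hQ : coeffField f = ⊥ := hf.coeffField_eq_bot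
  have hreal : ∀ n, (cuspCoeff f n).im = 0 := cuspCoeff_im_eq_zero_of_coeffField_eq_bot hQ
  have h2N : ¬ 2 ∣ N := not_dvd_level_of_isNewformOf hf hord.1
  have ha₂ : cuspCoeff f 2 = ((W.frobeniusTrace 2 : ℤ) : ℂ) :=
    cuspCoeff_eq_frobeniusTrace_of_isNewformOf_holds hf hord.1
  have hc : ∀ k : ℕ, ‖padicLCoeff f (unitRoot W 2 : ℚ_[2]) k‖ ≤ (2 : ℝ) ^ (-((s : ℤ) + 1)) := by
    intro k
    have h := hsmall k
    rwa [PowerSeries.coeff_C_mul, coeff_padicLFunction, norm_mul, hϖ, one_mul] at h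
  exact norm_two_mul_msdMeasure_le_of_forall_norm_padicLCoeff_le_of_odd f (unitRoot W 2 : ℚ_[2])
    (msdMeasure_distribution_of_isNewformOf hord hf)
    (norm_msdMeasure_two_le_two_auto hf.1 hreal h2N ha₂ hαinv hαeq) hc n hb

/-- **S2, analytic half, AT THE `X₀(N)`-OPTIMAL CURVE (modulo Abbes–Ullmo): if `AnalyticMuLE W 2 s` FAILS at a globally
minimal, good-ordinary-at-`2` curve `W` carrying a LATTICE-OPTIMAL parametrisation datum `D` at level `N_W`, then every
doubled MSD value `2μ_{D.f,α}(b + 2ⁿ⁺²ℤ₂)`, `b` odd, has norm `≤ 2^{-(s+1)}`.**  The failing certificate names a newform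
`f = D.f` (`IsNewformOf.unique`) and the ratio `ϖ` with `ϖ·Ω(W) = Ω⁺_f`; `Ω(W) = |c|·Ω⁺_f` exactly at an optimal datum
(`realPeriodRat_eq_abs_mul_plusPeriod_of_latticeEq`) and `2 ∤ c` (Abbes–Ullmo Thm. A at `p = 2 ∤ N_W`, the print binder
`hAU`), so `ϖ = |c|⁻¹` is a 2-adic unit and §4 applies.  This is the input «`μ(ϖ₀·L₂) ≥ s+1` ⟹ measure values
`≡ 0 (mod 2^{s+1})`» of card #8's piece S2 at the optimal curve, now a kernel theorem mod AU.
[cite: AbbesUllmo1996, Thm. A] [cite: MazurTateTeitelbaum1986Invent, §I.10–I.13] -/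
theorem norm_two_mul_msdMeasure_le_of_not_analyticMuLE_of_optimal
    (hAU : abbesUllmo_not_dvd_maninConstant_of_not_dvd_level) (hord : IsOrdinaryAt W 2)
    [NeZero (W.conductorNorm ℤ)] (D : ModularParametrizationData W (W.conductorNorm ℤ))
    (hopt : ∀ z ∈ D.L.lattice, ∃ w ∈ periodLattice D.f, z = D.c * w) {s : ℕ}
    (hnot : ¬ Summit.BirchSwinnertonDyer.Rank1Residual.X1.MuPart.AnalyticMuLE W 2 s)
    (n : ℕ) {b : ZMod (2 ^ (n + 2))} (hb : ¬ 2 ∣ b.val) :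
    ‖2 * msdMeasure D.f (unitRoot W 2 : ℚ_[2]) (n + 2) b‖ ≤ (2 : ℝ) ^ (-((s : ℤ) + 1)) := by
  haveI : Fact (Nat.Prime 2) := ⟨Nat.prime_two⟩
  unfold Summit.BirchSwinnertonDyer.Rank1Residual.X1.MuPart.AnalyticMuLE at hnot
  push Not at hnot
  obtain ⟨_, f, hf, ϖ, hϖ, hall⟩ := hnot
  have hfD : f = D.f := hf.unique D.isNewformOf
  subst hfD
  -- `ϖ` is a 2-adic unit: `Ω(W) = |c|·Ω⁺_f`, `2 ∤ c`
  have hN2 : ¬ 2 ∣ W.conductorNorm ℤ := not_dvd_level_of_isNewformOf D.isNewformOf hord.1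
  have hc2 : ¬ ((2 : ℕ) : ℤ) ∣ D.maninConstant := hAU W D hopt 2 Nat.prime_two hN2
  have hplus : 0 < plusPeriod D.f :=
    IsNewform0.plusPeriod_pos_holds D.isNewformOf.1 D.isNewformOf.coeffField_eq_bot
  have hΩ : W.realPeriodRat = |(D.c : ℝ)| * plusPeriod D.f := D.realPeriodRat_eq_abs_mul_plusPeriod_of_latticeEq hopt
  have hc0 : (D.c : ℝ) ≠ 0 := by
    have h : ¬ ((2 : ℕ) : ℤ) ∣ |D.c| := by rw [dvd_abs]; exact hc2
    intro h0
    have : D.c = 0 := by exact_mod_cast h0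
    rw [this, abs_zero] at h
    exact h (dvd_zero _)
  -- `ϖ = 1/|c|`
  set c' : ℤ := |D.c| with hc'
  have hc'R : (c' : ℝ) = |(D.c : ℝ)| := by rw [hc']; push_cast; rfl
  have hc'0 : (c' : ℝ) ≠ 0 := by rw [hc'R]; exact abs_ne_zero.mpr hc0
  have hϖR : (ϖ : ℝ) = ((c' : ℚ)⁻¹ : ℚ) := by
    have h1 : (ϖ : ℝ) * ((c' : ℝ) * plusPeriod D.f) = plusPeriod D.f := by rw [hc'R, ← hΩ]; exact hϖ
    have h2 : (ϖ : ℝ) * (c' : ℝ) = 1 := by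
      have := mul_right_cancel₀ hplus.ne' (by rw [mul_assoc, h1, one_mul] : (ϖ : ℝ) * (c' : ℝ) * plusPeriod D.f = 1 * plusPeriod D.f)
      exact this
    push_cast
    exact eq_inv_of_mul_eq_one_left h2
  have hϖQ : ϖ = (c' : ℚ)⁻¹ := by exact_mod_cast hϖR
  have hϖu : ‖(ϖ : ℚ_[2])‖ = 1 := by
    have hcast : (ϖ : ℚ_[2]) = ((c' : ℤ) : ℚ_[2])⁻¹ := by rw [hϖQ]; push_cast; rfl
    rw [hcast, norm_inv]
    have hc2' : ¬ (2 : ℤ) ∣ c' := by rw [hc', dvd_abs]; exact_mod_cast hc2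
    have hle : ‖((c' : ℤ) : ℚ_[2])‖ ≤ 1 := Padic.norm_int_le_one _
    have hnlt : ¬ ‖((c' : ℤ) : ℚ_[2])‖ < 1 := by
      rw [Padic.norm_intCast_lt_one_iff]; exact_mod_cast hc2'
    rw [le_antisymm hle (not_lt.mp hnlt), inv_one]
  exact norm_two_mul_msdMeasure_le_of_forall_norm_coeff_le W hord D.isNewformOf hϖu
    (fun k => by exact_mod_cast hall k) n hb

end Curve

end Summit.BirchSwinnertonDyer.BirchSwinnertonDyer.Theorems.AnalyticMuTwo

end
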